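import Summits.HodgeConjecture.HodgeConjecture.Theorems.F0P3cStCharTSLdsFields                     -- ★ p8513xx (LH6-p05 g4) S5: `hasJacquetExponent_of_intertwiningMap_ne_zero`, `not_subsingleton_coinvariants_of_ne_zero`; brings ★ N1∕N2 holds, ★ Frobenius, ★ N7 finite-dimensionality, ★ admissibility of every class
import Literature.NumberTheory.Automorphic.JacquetExponentUnique                                     -- ★ G5 `HasJacquetExponent.eq_of_equiv_twist_trivial` («`r(π) ≅ θ` ⇒ the only exponent is `θ`»)
import HarnessLib

/-!
# F0 · P3c · line LH6 «StCharTS» — brick «CUSP-SUPPORT★» (datum road, S7 part 2, FILE A): THE CUSPIDAL SUPPORT OF A CLASS WITH ONE-DIMENSIONAL JACQUET MODULE —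
# if `r(π) ≅ θ` and `π` is a constituent of `i_G(χ)`, then `χ = θ` or `wχ = θ`  (`G = U(Φ₃)(L⁺_v)`, `v` non-split)

Cell `hodgecm-mathlib`, crux `H413` (`stmt-HodgeConjecture-24833`), line LH6 `Cruxes/H413/Lines/F0_P3c_StCharTSPaydown.lean` (organ (S-𝔇) `stub_EllipticPackage`, its
PAIR-currency conjunct (PS2) «`¬ IsL2 π → IsL2 σ → IsEllipticPair π σ → Tr π + Tr σ = Tr i_G(par π)`» read with THE ∃-witness `par` of ★ «PAR-FIELD★» (p851306), whose
only exported property off the irreducible principal series is «`π` is a constituent of `i_G(par π)`» — an opaque choice).  Seat LH6-p03 (g4); THEOREMS ONLY (no `def`,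
no named fact, no `instance`, no notation, no `sorry`; axioms ⊆ {propext, Classical.choice, Quot.sound}); `--supports stmt-HodgeConjecture-24833`.  FILE A of the
slice «PS2-KIND3» (MAP-DATUM-ROAD v3, LH6-p01 (g4)): the generic representation-theoretic core, reusable for kind 2 (`{St_G(ψ), ψ∘det}`, S4b) and for (UNIQ-PAR).
HONEST LABEL: HC_CM is proved only modulo the 7 printed citations (2 remaining: hLiu418 = stmt-HodgeConjecture-24832, h413 = stmt-HodgeConjecture-24833) until rung 0
closes; count-neutral.

THE MATHEMATICS ([Casselman1995, Cor. 6.3.9 (b); Thm. 3.2.4 (Frobenius); §4.4]; [BernsteinZelevinsky1977, §2.3]; [Rogawski1990, §12.1–12.2 pp. 171–174]).  Let `π` be an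
irreducible smooth representation of `G = U(Φ₃)(L⁺_v)` whose NORMALISED Jacquet module is one-dimensional, `r(π) ≅ θ` (`θ` a character of the diagonal torus; in the
tree `Nonempty ((π.normalizedJacquet B).Equiv ((trivial ℂ T ℂ).twist θ))` — the Jacquet datum ★ `F0P3KeysLabelledPair.labelledPair_of_reducible` delivers for Keys'
`π²(ξ)` (`θ = χ_ξ`) and `πⁿ(ξ)` (`θ = wχ_ξ`)).  If the CLASS of `π` is a constituent of a principal series `i_G(χ) = cmPrincipalSeries L 3 v (cmTorusCharPair L v χ₁ χ₂)`
(continuous `χ₁, χ₂`), then by ★ N2 (`u3PrincipalSeriesConstituentEmbeds`, Casselman Cor. 6.3.9 (b), hypothesis-free over ★ N1) some representative `π′ ≅ π` EMBEDS into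
`i_G(χ)` or into `i_G(wχ)`; composing with the equivalence, `π` itself embeds; by Frobenius reciprocity (★ `frobenius_cmPrincipalSeries`) the embedding is a non-zero
`T`-map `r(π) → ℂ_χ` (resp. `ℂ_{wχ}`), hence `χ` (resp. `wχ`) is an EXPONENT of `π` (★ `hasJacquetExponent_of_intertwiningMap_ne_zero`, the Jacquet module being
finite-dimensional by ★ N7 `finiteDimensional_coinvariants_of_irreducible`); and a representation with `r(π) ≅ θ` has `θ` as its ONLY exponent (★ G5
`HasJacquetExponent.eq_of_equiv_twist_trivial`).  Hence **`χ = θ ∨ wχ = θ`** as characters of the torus (`χ = cmTorusCharPair L v χ₁ χ₂`, `wχ = cmWeylTorusCharPair L v χ₁ χ₂`):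
`cmTorusCharPair_eq_or_weyl_eq_of_isConstituentOf`.  Read contrapositively: the «cuspidal support» `{χ, wχ}` of such a class is determined by `θ` — the bookkeeping
print uses silently in §12.2 («`i_G(χ)` and `i_G(wχ)` have the same sets of constituents») and in the proof of L. 12.7.2 p. 192.

* §1 `hasJacquetExponent_of_injective_comp_equiv` — an equivalence `π ≅ π′` followed by an embedding `π′ ↪ i_G(χ′)` makes `χ′` an exponent of `π`.
* §2 THE HEAD `cmTorusCharPair_eq_or_weyl_eq_of_isConstituentOf` (carrier `↥(unitaryGroupOfForm (conjLocal L c̄ v) (cmLocalForm L 3 v))` = ★ N2's; `= Gqs L v`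
  definitionally).

## References
* [Rogawski1990] J. D. Rogawski, *Automorphic Representations of Unitary Groups in Three Variables*, Ann. of Math. Stud. 123 (1990): §12.1 pp. 171–172; §12.2
  pp. 173–174 («`i_G(χ)` and `i_G(wχ)` have the same sets of constituents»); §12.7 L. 12.7.2 (proof) p. 192.
* [Casselman1995] W. Casselman, *Introduction to the theory of admissible representations of p-adic reductive groups* (1974∕1995): Thm. 3.2.4 (Frobenius
  reciprocity), §4.4 p. 45 (exponents), Cor. 6.3.9 (b) p. 60.
* [BernsteinZelevinsky1977] I. N. Bernstein, A. V. Zelevinsky, *Induced representations of reductive p-adic groups I*, Ann. Sci. ÉNS 10 (1977): §2.3.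
-/

set_option autoImplicit false
-- the mandated namespace has the single-problem summit's repeated segment (`HodgeConjecture.HodgeConjecture`)
set_option linter.dupNamespace false

noncomputable section

open NumberField IsDedekindDomain MeasureTheory
open scoped Matrix

open Literature.NumberTheory.Rogawski1990 Literature.NumberTheory.Automorphic Literature.NumberTheory.Automorphic.UnitaryGroup

namespace Summit.HodgeConjecture.HodgeConjecture.Cruxes.H413.F0P3cStCharTSCuspSupport

variable (L : Type) [Field L] [NumberField L] [IsCMField L] (v : HeightOneSpectrum (𝓞 ↥(maximalRealSubfield L)))

/-! ## §1 An embedding of an equivalent representation gives an exponent -/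

set_option synthInstance.maxHeartbeats 400000 in
set_option maxHeartbeats 8000000 in
-- statement∕proof-heavy: the `SmoothInd` carrier of `cmPrincipalSeries` and the Jacquet-module quotient types (same class as ★ LdsFields §1's 8000000)
/-- **`π ≅ π′ ↪ i_G(χ′)` ⇒ `χ′` is a (normalised) exponent of `π`.**  For an irreducible smooth `π` on `G = U(Φ₃)(L⁺_v)` (`v` non-split), an equivalence
`e : π ≅ π′` and an injective intertwining map `π′ → i_G(χ′)`: the composite `π → i_G(χ′)` is injective, hence non-zero; Frobenius reciprocity (★
`frobenius_cmPrincipalSeries`) turns it into a non-zero `T`-map `r(π) → ℂ_{χ′}`, and an eigenvector argument (★ `hasJacquetExponent_of_intertwiningMap_ne_zero`; the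
Jacquet module is finite-dimensional by ★ `finiteDimensional_coinvariants_of_irreducible`) gives the exponent. [cite: Casselman1995, Thm. 3.2.4; §4.4 p. 45]
[cite: BernsteinZelevinsky1977, §2.3] -/
theorem hasJacquetExponent_of_injective_comp_equiv
    (hns : ∀ w : PlacesOver L v, IsCMField.complexConj L • w.1 = w.1)
    (r r' : SmoothIrrep ↥(unitaryGroupOfForm (conjLocal L (IsCMField.complexConj L) v) (cmLocalForm L 3 v)))
    (e : r.ρ.Equiv r'.ρ)
    (χ' : ↥(torusU (conjLocal L (IsCMField.complexConj L) v) (cmLocalForm L 3 v)) →* ℂˣ)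
    (f : r'.ρ.IntertwiningMap (cmPrincipalSeries L 3 v χ')) (hf : Function.Injective f) :
    haveI := locallyCompactSpace_cmBorelU L 3 v
    r.ρ.HasJacquetExponent (cmBorelTriple L 3 v) χ' := by
  haveI := locallyCompactSpace_cmBorelU L 3 v
  -- the composite embedding `π → i_G(χ′)`
  let f' : r.ρ.IntertwiningMap (cmPrincipalSeries L 3 v χ') := f.comp e.toIntertwiningMap
  have hf' : Function.Injective f' := by
    intro x y hxy
    have h1 : f (e.toIntertwiningMap x) = f (e.toIntertwiningMap y) := by
      simpa only [f', Representation.IntertwiningMap.comp_apply] using hxy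
    have h2 := hf h1
    rw [← Representation.Equiv.toLinearEquiv_apply, ← Representation.Equiv.toLinearEquiv_apply] at h2
    exact e.toLinearEquiv.injective h2
  -- Frobenius reciprocity for `π`
  obtain ⟨fr⟩ := F0P2nFrobeniusCmPrincipalSeries.frobenius_cmPrincipalSeries L v χ' r.ρ r.isSmooth
  haveI : Nontrivial r.V := Representation.IsIrreducible.nontrivial r.ρ
  have hf0 : f' ≠ 0 := by
    intro h0
    obtain ⟨x, hx⟩ := exists_ne (0 : r.V)
    exact hx (hf' (by rw [h0, map_zero]; rfl))
  have hef : fr f' ≠ 0 := fun h0 => hf0 ((LinearEquiv.map_eq_zero_iff fr).1 h0)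
  have hg : (fr f').toLinearMap ≠ 0 := fun h0 =>
    hef (Representation.IntertwiningMap.ext (LinearMap.ext fun x => by rw [h0, LinearMap.zero_apply]; rfl))
  haveI := F0P2oN7OfCasselmanCriterion.finiteDimensional_coinvariants_of_irreducible L v hns r.ρ r.isIrreducible r.isSmooth
    (F0P3cStCharTSLdsFields.not_subsingleton_coinvariants_of_ne_zero (cmBorelTriple L 3 v) r.ρ (fr f') hg)
  exact F0P3cStCharTSLdsFields.hasJacquetExponent_of_intertwiningMap_ne_zero (cmBorelTriple L 3 v) r.ρ
    (torusU_mul_comm (conjLocal L (IsCMField.complexConj L) v) (cmLocalForm L 3 v)) χ' (fr f') hg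

/-! ## §2 THE HEAD — the cuspidal support of a class with `r(π) ≅ θ` -/

set_option synthInstance.maxHeartbeats 400000 in
set_option maxHeartbeats 8000000 in
-- statement∕proof-heavy: the `SmoothInd` carrier of `cmPrincipalSeries` and the Jacquet-module quotient types (same class as ★ LdsFields §1's 8000000)
/-- **«CUSP-SUPPORT★» — IF `r(π) ≅ θ` AND `⟦π⟧` IS A CONSTITUENT OF `i_G(χ₁, χ₂)`, THEN `χ = θ` OR `wχ = θ`** (`G = U(Φ₃)(L⁺_v)`, `v` non-split, continuous
`χ₁, χ₂`; `χ = cmTorusCharPair L v χ₁ χ₂`, `wχ = cmWeylTorusCharPair L v χ₁ χ₂`).  By ★ N2 some representative embeds into `i_G(χ)` or `i_G(wχ)`; it is equivalent to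
the representative carrying the Jacquet datum (★ `IrrClass.mk_eq_mk_iff`); §1 makes `χ` (resp. `wχ`) an exponent of the latter; ★ G5 (`r(π) ≅ θ` ⇒ the only exponent
is `θ`) concludes. [cite: Rogawski1990, §12.2 pp. 173–174] [cite: Casselman1995, Cor. 6.3.9 (b); Thm. 3.2.4; §4.4 p. 45] [cite: BernsteinZelevinsky1977, §2.3] -/
theorem cmTorusCharPair_eq_or_weyl_eq_of_isConstituentOf
    (hns : ∀ w : PlacesOver L v, IsCMField.complexConj L • w.1 = w.1)
    (χ₁ : (LocalRing L v)ˣ →* ℂˣ) (χ₂ : ↥(normOneUnits (conjLocal L (IsCMField.complexConj L) v)) →* ℂˣ)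
    (hc1 : Continuous (fun x => ((χ₁ x : ℂˣ) : ℂ))) (hc2 : Continuous (fun x => ((χ₂ x : ℂˣ) : ℂ)))
    (θ : ↥(torusU (conjLocal L (IsCMField.complexConj L) v) (cmLocalForm L 3 v)) →* ℂˣ)
    (c : IrrClass ↥(unitaryGroupOfForm (conjLocal L (IsCMField.complexConj L) v) (cmLocalForm L 3 v)))
    (hc : c.IsConstituentOf (cmPrincipalSeries L 3 v (cmTorusCharPair L v χ₁ χ₂)))
    (hθ : haveI := locallyCompactSpace_cmBorelU L 3 v
      ∃ r : SmoothIrrep ↥(unitaryGroupOfForm (conjLocal L (IsCMField.complexConj L) v) (cmLocalForm L 3 v)), IrrClass.mk r = c ∧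
        Nonempty ((r.ρ.normalizedJacquet (cmBorelTriple L 3 v)).Equiv
          ((Representation.trivial ℂ ↥(torusU (conjLocal L (IsCMField.complexConj L) v) (cmLocalForm L 3 v)) ℂ).twist θ))) :
    cmTorusCharPair L v χ₁ χ₂ = θ ∨ cmWeylTorusCharPair L v χ₁ χ₂ = θ := by
  haveI := locallyCompactSpace_cmBorelU L 3 v
  -- N2: a representative `r'` of `c` embeds into `i_G(χ)` or `i_G(wχ)`
  obtain ⟨r', hr'c, hemb⟩ := F0P3U3ConstituentEmbedsOfJacquet.u3PrincipalSeriesConstituentEmbeds_of_jacquetFiltration L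
    (F0P3U3PrincipalSeriesJacquetFiltrationHolds.U3PrincipalSeriesJacquetFiltration_holds L) v hns χ₁ χ₂ hc1 hc2 c hc
  -- the representative `r` carrying the Jacquet datum, and `r ≅ r'`
  obtain ⟨r, hrc, ⟨eθ⟩⟩ := hθ
  have hmk : IrrClass.mk r = IrrClass.mk r' := by rw [hrc, hr'c]
  obtain ⟨e⟩ := (IrrClass.mk_eq_mk_iff r r').1 hmk
  rcases hemb with ⟨f, hf⟩ | ⟨f, hf⟩
  · exact Or.inl (Representation.HasJacquetExponent.eq_of_equiv_twist_trivial (cmBorelTriple L 3 v) eθ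
      (hasJacquetExponent_of_injective_comp_equiv L v hns r r' e _ f hf))
  · exact Or.inr (Representation.HasJacquetExponent.eq_of_equiv_twist_trivial (cmBorelTriple L 3 v) eθ
      (hasJacquetExponent_of_injective_comp_equiv L v hns r r' e _ f hf))

end Summit.HodgeConjecture.HodgeConjecture.Cruxes.H413.F0P3cStCharTSCuspSupport

end
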